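import Literature.NumberTheory.EllipticCurves.PotentialGoodReductionInertiaProofs
import HarnessLib

/-!
# Decomposition groups under `Γ_L → Γ_K` for primes of the absolute integers (Neukirch I §9 (9.4);
# proofs only)

`Proofs`-style file (THEOREMS ONLY), topic `NumberTheory/EllipticCurves`; the decomposition-group
companion of the tree's `exists_primesAbove_mem_inertia_iff` (`PotentialGoodReductionInertiaProofs`,
inertia groups). For an algebraic extension `L/K`, the chosen isomorphism `ι : K̄ → L̄`
(`absClosureEmbedding K L`) maps `\bar ℤ_K` onto `\bar ℤ_L` `Γ_L`-equivariantly
(`ι (γ|_{K̄} • x) = γ • ι x`); hence for a prime `𝔔` of `\bar ℤ_L` above a place `w` of `L` over `v`,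
the prime `𝔓 = ι⁻¹(𝔔)` of `\bar ℤ_K` lies above `v` and `γ • 𝔔 = 𝔔 ⇒ γ|_{K̄} • 𝔓 = 𝔓`:

* `exists_primesAbove_decompositionSubgroup_le_comap` — **for `𝔔 ∈ w.primesAbove` there is
  `𝔓 ∈ v.primesAbove` with `D_𝔔(L) ≤ res⁻¹(D_𝔓(K))`** («`G_𝔔(L̄|L) = G_𝔓(K̄|K) ∩ G_L`», Neukirch,
  *Algebraic Number Theory*, Ch. I §9, (9.4), for the infinite extensions `K̄/K ⊇ L`).

## References

* [NeukirchANT1999] J. Neukirch, *Algebraic Number Theory*, Springer 1999, Ch. I §9 (9.4).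
* [SerreLocalFields1979] J.-P. Serre, *Local Fields*, GTM 67, Ch. I §7, Prop. 22.
-/

noncomputable section

open scoped Classical NumberField
open Field IsDedekindDomain

universe u

namespace Literature.NumberTheory.EllipticCurves

variable (K L : Type u) [Field K] [Field L] [Algebra K L]

/-- **Decomposition groups under restriction `Γ_L → Γ_K`** (Neukirch I §9 (9.4):
`G_𝔔(L) = G_𝔓 ∩ G_L`; here the inclusion needed for transporting Galois-stable objects). Let `L/K` be
algebraic, `w` a finite place of `L` over the place `v` of `K`, and `𝔔` a prime of `\bar ℤ_L` above
`w`. Then there is a prime `𝔓` of `\bar ℤ_K` above `v` (namely `ι⁻¹(𝔔)` for the chosen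
`ι : K̄ ≅ L̄`) such that every `γ ∈ Γ_L` in the decomposition group of `𝔔` restricts to an element
of the decomposition group of `𝔓`. [cite: NeukirchANT1999, Ch. I §9 Prop. (9.4)] -/
theorem exists_primesAbove_decompositionSubgroup_le_comap [Algebra.IsAlgebraic K L]
    {v : HeightOneSpectrum (𝓞 K)} {w : HeightOneSpectrum (𝓞 L)}
    (hw : w.asIdeal.under (𝓞 K) = v.asIdeal)
    {𝔔 : Ideal (GaloisRepresentations.absIntegers (𝓞 L) L)} (h𝔔 : 𝔔 ∈ w.primesAbove) :
    ∃ 𝔓 : Ideal (GaloisRepresentations.absIntegers (𝓞 K) K), 𝔓 ∈ v.primesAbove ∧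
      ∀ γ : absoluteGaloisGroup L, γ ∈ 𝔔.decompositionSubgroup (absoluteGaloisGroup L) →
        GaloisRepresentations.absGaloisRestrict K L γ ∈ 𝔓.decompositionSubgroup (absoluteGaloisGroup K) := by
  have hbij := absClosureEmbedding_bijective K L
  -- the map `ιₒ : \bar ℤ_K → \bar ℤ_L`, a `Γ_L`-equivariant ring isomorphism (as in the inertia file)
  let ιo : GaloisRepresentations.absIntegers (𝓞 K) K →+* GaloisRepresentations.absIntegers (𝓞 L) L :=
    ((GaloisRepresentations.absClosureEmbedding K L).toRingHom.comp
      (GaloisRepresentations.absIntegers (𝓞 K) K).val.toRingHom).codRestrict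
      (GaloisRepresentations.absIntegers (𝓞 L) L)
      (fun x => GaloisRepresentations.absClosureEmbedding_mem_absIntegers K L x)
  have hιo : ∀ x : GaloisRepresentations.absIntegers (𝓞 K) K,
      ((ιo x : GaloisRepresentations.absIntegers (𝓞 L) L) : AlgebraicClosure L) =
        GaloisRepresentations.absClosureEmbedding K L x := fun _ => rfl
  have hιo_inj : Function.Injective ιo := fun x y h => by
    apply Subtype.ext
    apply hbij.1
    exact congrArg Subtype.val h
  have hιo_surj : Function.Surjective ιo := fun y => by
    obtain ⟨x, hx⟩ := hbij.2 (y : AlgebraicClosure L)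
    exact ⟨⟨x, mem_absIntegers_of_absClosureEmbedding_mem K L (hx ▸ y.2)⟩, Subtype.ext hx⟩
  have hιo_smul : ∀ (γ : absoluteGaloisGroup L) (x : GaloisRepresentations.absIntegers (𝓞 K) K),
      ιo (GaloisRepresentations.absGaloisRestrict K L γ • x) = γ • ιo x := fun γ x => by
    apply Subtype.ext
    rw [hιo]
    change GaloisRepresentations.absClosureEmbedding K L
        (GaloisRepresentations.absGaloisRestrict K L γ • (x : AlgebraicClosure K)) =
      γ • GaloisRepresentations.absClosureEmbedding K L x
    exact GaloisRepresentations.absGaloisRestrict_apply_smul K L γ x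
  have hιo_alg : ιo.comp (algebraMap (𝓞 K) (GaloisRepresentations.absIntegers (𝓞 K) K)) =
      (algebraMap (𝓞 L) (GaloisRepresentations.absIntegers (𝓞 L) L)).comp (algebraMap (𝓞 K) (𝓞 L)) := by
    ext r
    change GaloisRepresentations.absClosureEmbedding K L (algebraMap (𝓞 K) (AlgebraicClosure K) r) =
      algebraMap (𝓞 L) (AlgebraicClosure L) (algebraMap (𝓞 K) (𝓞 L) r)
    rw [IsScalarTower.algebraMap_apply (𝓞 K) K (AlgebraicClosure K), AlgHom.commutes,
      IsScalarTower.algebraMap_apply (𝓞 L) L (AlgebraicClosure L),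
      ← IsScalarTower.algebraMap_apply (𝓞 K) (𝓞 L) L, IsScalarTower.algebraMap_apply (𝓞 K) K L,
      ← IsScalarTower.algebraMap_apply K L (AlgebraicClosure L)]
  -- the prime `𝔓 = ιₒ⁻¹(𝔔)`
  haveI : 𝔔.IsPrime := h𝔔.1
  set 𝔓 : Ideal (GaloisRepresentations.absIntegers (𝓞 K) K) := 𝔔.comap ιo with h𝔓def
  have hmap : 𝔓.map ιo = 𝔔 := Ideal.map_comap_of_surjective ιo hιo_surj 𝔔
  have hunder : 𝔓.under (𝓞 K) = v.asIdeal := by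
    have h1 : (𝔔.under (𝓞 L)).under (𝓞 K) = v.asIdeal := by
      rw [← hw]
      exact congrArg (fun I : Ideal (𝓞 L) => I.under (𝓞 K)) h𝔔.2.over.symm
    change Ideal.comap (algebraMap (𝓞 K) (GaloisRepresentations.absIntegers (𝓞 K) K)) (𝔔.comap ιo) = v.asIdeal
    rw [Ideal.comap_comap, hιo_alg, ← Ideal.comap_comap]
    exact h1
  refine ⟨𝔓, ⟨Ideal.comap_isPrime ιo 𝔔, ⟨hunder.symm⟩⟩, fun γ hγ => ?_⟩
  rw [Ideal.mem_decompositionSubgroup_iff] at hγ ⊢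
  -- `res γ • 𝔓 = 𝔓` from `γ • 𝔔 = 𝔔`
  ext x
  rw [Ideal.mem_pointwise_smul_iff_inv_smul_mem, h𝔓def, Ideal.mem_comap, Ideal.mem_comap, ← map_inv,
    hιo_smul, ← Ideal.mem_pointwise_smul_iff_inv_smul_mem, hγ]

end Literature.NumberTheory.EllipticCurves

end
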